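import Mathlib
import HarnessLib
import Summits.HubbardSuperconductivity.HubbardSuperconductivity.Theorems.KLProgrammeKLRegimeSplitPairLadderExtra
import Summits.HubbardSuperconductivity.HubbardSuperconductivity.Theorems.KLProgrammeKLRegimeSplitLegStaging
import Summits.HubbardSuperconductivity.HubbardSuperconductivity.Theorems.KLProgrammeKLRegimeSplitPairFrozen
import Summits.HubbardSuperconductivity.HubbardSuperconductivity.Theorems.KLProgrammeKLRegimeSplitRowZeroMajorant

/-!
# Route `KLProgramme` — row 0′ of the K3 supplier map, GENERIC in the per-step extra remainder, and its instance on the V5 engine slot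
# (`PairLadderStepAtV5` / `PairValueIncrementAtV5` with the `Q`-staged leg majorant `legDressBarQ`, Δ15) ⇒ (B1-v2′) `PairArrayAtV2`

Cell gate-hubbard-kl, seat hubbard-kl-r2d-p1 (child `KLRegimeBetaSplit`).  `pairLadder_envelope_v4` (`…SplitPairLadderV4`) hard-wires the V4 extra
term `thermalBar + legDressBar`; plan g10's Δ15 ruling (14:03Z) restages the leg majorant at `Q` level (`legDressBarQ G P Q U n c =
Q.CR·((Klam U)²·4^{-n} + (Klam|U|)³)·c`, p1's `…SplitLegStaging`) and widens child 1's output tolerance to `(P.C_W + klLegKappa·Q.CR·Klam³)·U²`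
(`PairArrayAtV2`, `klLegKappa = 4000`).  So here the ladder is proved ONCE for an ARBITRARY nonnegative per-step extra term `X j k k'` with a
per-entry scale-sum bound `Σ_{i<n} X (i+1) k k' ≤ Xtot` and a per-scale bound `X (i+1) k k' ≤ Xsup` (**`pairLadder_envelope_extra`**, fed to
`sWaveCascade_envelope_sources` exactly as in the V4 file), then instantiated: **`pairArray_envelope_v5`** (every total momentum; frozen part by
p3's `pairFrozen_increment_extra`), **`pairArrayAtV2_of_engineBoundsV5S`**, **`pairArrayAtV2_of_engineBoundsV5S_explicit`** (constant chosen: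
`C_W ≥ 8(Σ_χ(abot+atop)+1) + 17(aplus Klam² Z + cloc Klam²(1−4^{−θ})⁻¹ + 1) + 1 + 23·CF·Klam²`, the `Q.CR·Klam³`-part `≤ 424 ≤ klLegKappa`,
smallness `2·CR·Klam³·|U| ≤ 1`, volume `17·Σ_{j<n} CL β j/L ≤ U²`, NO-ONSET `160·Crow5·U²·bhi·n ≤ 1`).  Everything is proved.
-/

noncomputable section

namespace Summit.HubbardSuperconductivity.HubbardSuperconductivity.Theorems.KLRegimeSplit

set_option linter.dupNamespace false -- summit = problem name (single-conjunct summit), D-0017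

open Finset Literature.MathematicalPhysics.QuantumLattice Literature.Probability.LatticeModels
open Summit.HubbardSuperconductivity.HubbardSuperconductivity.Theorems.KLProgrammeLegKernels
open Summit.HubbardSuperconductivity.HubbardSuperconductivity.Theorems.CooperChannelRiccatiFlow
open Summit.HubbardSuperconductivity.HubbardSuperconductivity.Theorems.SWaveCascade

section Model

variable (L M : ℕ) [NeZero L] [NeZero M]

variable {G : GeoConsts} {P : SplitConsts} {Qc : EngConsts}

/-- `legDressBarQ … n c ≤ CR·((Klam U)² + (Klam|U|)³)·c` (drop the profile `4^{-n} ≤ 1`). -/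
theorem legDressBarQ_le {P : SplitConsts} {Qc : EngConsts} (G : GeoConsts) (hK : 0 ≤ P.Klam) (hCR : 0 ≤ Qc.CR) (U : ℝ) (n c : ℕ) :
    legDressBarQ G P Qc U n c ≤ Qc.CR * ((P.Klam * U) ^ 2 + (P.Klam * |U|) ^ 3) * c := by
  unfold legDressBarQ
  have h1 : ((4 : ℝ) ^ n)⁻¹ ≤ 1 := inv_le_one_of_one_le₀ (one_le_pow₀ (by norm_num))
  have h2 : 0 ≤ (P.Klam * U) ^ 2 := sq_nonneg _
  have h3 : 0 ≤ (P.Klam * |U|) ^ 3 := pow_nonneg (mul_nonneg hK (abs_nonneg U)) 3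
  have h4 : (P.Klam * U) ^ 2 * ((4 : ℝ) ^ n)⁻¹ ≤ (P.Klam * U) ^ 2 := by nlinarith
  have hc : (0 : ℝ) ≤ c := Nat.cast_nonneg c
  exact mul_le_mul_of_nonneg_right (mul_le_mul_of_nonneg_left (by linarith) hCR) hc

omit [NeZero L] [NeZero M] in
/-- The scale sum of the `Q`-staged leg majorant along one 4-tuple of legs: `Σ_{m ≤ N} legDressBarQ m (legSliceCount m k) ≤
20·CR·((Klam U)² + (Klam|U|)³)` (each leg meets at most five slices). -/
theorem legDressBarQ_sum_le {P : SplitConsts} {Qc : EngConsts} (G : GeoConsts) (hK : 0 ≤ P.Klam) (hCR : 0 ≤ Qc.CR) (U μ : ℝ)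
    (K : TrigPolyC4v) (k : Fin 4 → TorusSite 2 L) (N : ℕ) :
    ∑ m ∈ range (N + 1), legDressBarQ G P Qc U m (legSliceCount L μ K m k) ≤
      20 * (Qc.CR * ((P.Klam * U) ^ 2 + (P.Klam * |U|) ^ 3)) := by
  set cr3 : ℝ := Qc.CR * ((P.Klam * U) ^ 2 + (P.Klam * |U|) ^ 3) with hcr3
  have hcr30 : 0 ≤ cr3 := mul_nonneg hCR (add_nonneg (sq_nonneg _) (pow_nonneg (mul_nonneg hK (abs_nonneg U)) 3))
  calc ∑ m ∈ range (N + 1), legDressBarQ G P Qc U m (legSliceCount L μ K m k)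
      ≤ ∑ m ∈ range (N + 1), cr3 * (legSliceCount L μ K m k : ℝ) :=
        sum_le_sum fun m _ => legDressBarQ_le G hK hCR U m _
    _ = cr3 * ∑ m ∈ range (N + 1), (legSliceCount L μ K m k : ℝ) := by rw [mul_sum]
    _ ≤ cr3 * 20 := by
        refine mul_le_mul_of_nonneg_left ?_ hcr30
        have h := legSliceCount_sum_le L μ K k N
        exact_mod_cast h
    _ = 20 * cr3 := by ring

/-- `CR·((Klam U)² + (Klam|U|)³) ≤ 2·CR·Klam³·U²` for `Klam ≥ 1`, `|U| ≤ 1`. -/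
theorem cr3_le {Klam CR U : ℝ} (hK : 1 ≤ Klam) (hCR : 0 ≤ CR) (hU1 : |U| ≤ 1) :
    CR * ((Klam * U) ^ 2 + (Klam * |U|) ^ 3) ≤ 2 * CR * Klam ^ 3 * U ^ 2 := by
  have hK0 : 0 ≤ Klam := zero_le_one.trans hK
  have hU2 : U ^ 2 = |U| ^ 2 := (sq_abs U).symm
  have ha : 0 ≤ |U| := abs_nonneg U
  have h1 : (Klam * |U|) ^ 3 ≤ Klam ^ 3 * |U| ^ 2 := by
    have : |U| ^ 3 ≤ |U| ^ 2 := by nlinarith [mul_nonneg ha ha]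
    calc (Klam * |U|) ^ 3 = Klam ^ 3 * |U| ^ 3 := by ring
      _ ≤ Klam ^ 3 * |U| ^ 2 := mul_le_mul_of_nonneg_left this (pow_nonneg hK0 3)
  have h2 : (Klam * U) ^ 2 ≤ Klam ^ 3 * |U| ^ 2 := by
    rw [mul_pow, hU2]
    exact mul_le_mul_of_nonneg_right (by nlinarith [mul_nonneg hK0 hK0]) (sq_nonneg _)
  rw [hU2]
  nlinarith [mul_le_mul_of_nonneg_left (add_le_add h2 h1) hCR]

/-- **Row 0′ on the V5 engine slot, every total momentum.**  From `PairLadderStepAtV5` at all `j ≤ n`, `PairValueIncrementAtV5` at all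
`1 ≤ j ≤ n`, `U ≥ 0`, `|U| ≤ 1`, `Klam ≥ 1`, `CR ≥ 0`, `n ≤ n_β` and the no-onset smallness: for every `Qm` there is `u ∈ [0, U]` with
`|𝒞_n(Q;k,k') − u| ≤ 8·(A + R) + (3·CF(Klam U)² + Xtot + Σ_{i<n} ē_i)` on the ball, `Xtot = (4/3)·CF(Klam U)² + 40·CR·Klam³·U²`,
`Xsup = CF(Klam U)² + 8·CR·Klam³·U²`. -/
theorem pairArray_envelope_v5 (hG : G.WF) (hP : P.WF) (hQc : Qc.WF) {β U μ : ℝ} {K : TrigPolyC4v} (hU : 0 ≤ U) (hU1 : |U| ≤ 1)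
    {n : ℕ} (hn : n ≤ nScales β) (hsteps : ∀ j ≤ n, PairLadderStepAtV5 L M G P Qc β U μ K j)
    (hincr : ∀ j, 1 ≤ j → j ≤ n → PairValueIncrementAtV5 L M G P Qc β U μ K j) (Qm : TorusSite 2 L)
    (hsmall : 8 * 20 * ((initDevBar G U + ∑ j ∈ range n, (drivePBar G P U j + eremBar G P Qc U β L j) +
        (4 / 3 * (G.CF * (P.Klam * U) ^ 2) + 40 * (Qc.CR * P.Klam ^ 3 * U ^ 2))) +
        (∑ j ∈ range n, (drivePBar G P U j + eremBar G P Qc U β L j) +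
          (G.CF * (P.Klam * U) ^ 2 + 8 * (Qc.CR * P.Klam ^ 3 * U ^ 2)))) * (G.bhi * n) ≤ 1) :
    ∃ u : ℝ, 0 ≤ u ∧ u ≤ U ∧ ∀ k ∈ klBall L μ K, ∀ k' ∈ klBall L μ K,
      ‖klPairAmplitude L M β U μ K n Qm k k' - (u : ℂ)‖ ≤
        8 * ((initDevBar G U + ∑ j ∈ range n, (drivePBar G P U j + eremBar G P Qc U β L j) +
            (4 / 3 * (G.CF * (P.Klam * U) ^ 2) + 40 * (Qc.CR * P.Klam ^ 3 * U ^ 2))) +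
          (∑ j ∈ range n, (drivePBar G P U j + eremBar G P Qc U β L j) +
            (G.CF * (P.Klam * U) ^ 2 + 8 * (Qc.CR * P.Klam ^ 3 * U ^ 2)))) +
        ((P.Klam * U) ^ 2 * (3 * G.CF) + (4 / 3 * (G.CF * (P.Klam * U) ^ 2) + 40 * (Qc.CR * P.Klam ^ 3 * U ^ 2)) +
          ∑ i ∈ range n, eremBar G P Qc U β L i) := by
  classical
  set τ : ℕ → ℝ := fun j => drivePBar G P U j + eremBar G P Qc U β L j with hτ
  have hτ0 : ∀ j, 0 ≤ τ j := fun j => add_nonneg (drivePBar_nonneg' hG U j) (eremBar_nonneg' hG hP hQc U β L j)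
  have hbhi : 0 ≤ G.bhi := hG.2.2.1.trans hG.2.2.2.1
  have hCF : 0 ≤ G.CF := hG.2.2.2.2.2.2.2.2.2.2.2.2.2.1
  have hK1 : 1 ≤ P.Klam := hP.1
  have hK0 : 0 ≤ P.Klam := zero_le_one.trans hK1
  have hCR : 0 ≤ Qc.CR := hQc.2.1
  set g2 : ℝ := G.CF * (P.Klam * U) ^ 2 with hg2
  have hg20 : 0 ≤ g2 := by positivity
  set q3 : ℝ := Qc.CR * P.Klam ^ 3 * U ^ 2 with hq3
  have hq30 : 0 ≤ q3 := by positivity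
  have hcr3 : Qc.CR * ((P.Klam * U) ^ 2 + (P.Klam * |U|) ^ 3) ≤ 2 * q3 := by
    have := cr3_le hK1 hCR hU1; simp only [hq3]; linarith
  have hinit0 : 0 ≤ initDevBar G U := by
    unfold initDevBar
    refine mul_nonneg (add_nonneg (sum_nonneg fun χ _ => add_nonneg (hG.2.1 χ) (hG.1 χ)) zero_le_one) (sq_nonneg U)
  have hSe0 : 0 ≤ ∑ i ∈ range n, eremBar G P Qc U β L i := sum_nonneg fun i _ => eremBar_nonneg' hG hP hQc U β L i
  -- the extra term
  set X : ℕ → TorusSite 2 L → TorusSite 2 L → ℝ := fun j k k' =>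
    thermalBar G P U β j + legDressBarQ G P Qc U j (legSliceCount L μ K j ![k', Qm - k', Qm - k, k]) with hX
  have hX0 : ∀ j k k', 0 ≤ X j k k' := fun j k k' =>
    add_nonneg (thermalBar_nonneg hCF P U β j) (legDressBarQ_nonneg G hK0 hCR U j _)
  have hXsup : ∀ (i : ℕ) (k k' : TorusSite 2 L), X (i + 1) k k' ≤ g2 + 8 * q3 := by
    intro i k k'
    have h1 := thermalBar_le hCF P U β (i + 1)
    have h2 := legDressBarQ_le G hK0 hCR U (i + 1) (legSliceCount L μ K (i + 1) ![k', Qm - k', Qm - k, k])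
    have h4 : (legSliceCount L μ K (i + 1) ![k', Qm - k', Qm - k, k] : ℝ) ≤ 4 := by
      exact_mod_cast legSliceCount_le_four L μ K (i + 1) _
    have h3 : Qc.CR * ((P.Klam * U) ^ 2 + (P.Klam * |U|) ^ 3) * (legSliceCount L μ K (i + 1) ![k', Qm - k', Qm - k, k] : ℝ) ≤
        2 * q3 * 4 := mul_le_mul hcr3 h4 (Nat.cast_nonneg _) (by positivity)
    simp only [hX, hg2] at *
    linarith
  have hXsum : ∀ (t : ℕ) (k k' : TorusSite 2 L), ∑ j ∈ Ioc t n, X j k k' ≤ 4 / 3 * g2 + 40 * q3 := by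
    intro t k k'
    have hsub : ∀ (f : ℕ → ℝ), (∀ j, 0 ≤ f j) → ∑ j ∈ Ioc t n, f j ≤ ∑ j ∈ range (n + 1), f j := fun f hf =>
      sum_le_sum_of_subset_of_nonneg (fun j hj => by simp only [mem_Ioc] at hj; exact mem_range.2 (by omega)) fun j _ _ => hf j
    have h1 : ∑ j ∈ Ioc t n, thermalBar G P U β j ≤ 4 / 3 * g2 :=
      (hsub _ fun j => thermalBar_nonneg hCF P U β j).trans (thermalBar_sum_le hCF P U β hn)
    have h2 : ∑ j ∈ Ioc t n, legDressBarQ G P Qc U j (legSliceCount L μ K j ![k', Qm - k', Qm - k, k]) ≤ 20 * (2 * q3) :=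
      ((hsub _ fun j => legDressBarQ_nonneg G hK0 hCR U j _).trans (legDressBarQ_sum_le L G hK0 hCR U μ K _ n)).trans
        (by nlinarith [hcr3])
    simp only [hX, sum_add_distrib]
    linarith
  have hXtot : ∀ k k' : TorusSite 2 L, ∑ i ∈ range n, X (i + 1) k k' ≤ 4 / 3 * g2 + 40 * q3 := by
    intro k k'
    have h1 : ∑ i ∈ range n, thermalBar G P U β (i + 1) ≤ 4 / 3 * g2 :=
      (sum_range_succ_shift_le (f := fun m => thermalBar G P U β m) (fun m => thermalBar_nonneg hCF P U β m) n).trans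
        (thermalBar_sum_le hCF P U β hn)
    have h2 : ∑ i ∈ range n, legDressBarQ G P Qc U (i + 1) (legSliceCount L μ K (i + 1) ![k', Qm - k', Qm - k, k]) ≤ 20 * (2 * q3) :=
      ((sum_range_succ_shift_le (f := fun m => legDressBarQ G P Qc U m (legSliceCount L μ K m ![k', Qm - k', Qm - k, k]))
          (fun m => legDressBarQ_nonneg G hK0 hCR U m _) n).trans (legDressBarQ_sum_le L G hK0 hCR U μ K _ n)).trans
        (by nlinarith [hcr3])
    simp only [hX, sum_add_distrib]
    linarith
  -- the frozen part between two scales `t ≤ n` once the pair momentum is resolved at `t + 1`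
  have hfrozen : ∀ t, t ≤ n → ((4 : ℝ) ^ (t + 1))⁻¹ < torusSupNorm (latticeMomentum L Qm 0, latticeMomentum L Qm 1) →
      ∀ k ∈ klBall L μ K, ∀ k' ∈ klBall L μ K,
        ‖klPairAmplitude L M β U μ K n Qm k k' - klPairAmplitude L M β U μ K t Qm k k'‖ ≤
          (P.Klam * U) ^ 2 * (3 * G.CF) + (4 / 3 * g2 + 40 * q3) + ∑ i ∈ range n, eremBar G P Qc U β L i := by
    intro t htn hexit
    refine pairFrozen_increment_extra L M hG hP hQc htn X (fun j hj hjn k hk k' hk' => ?_) (fun k _ k' _ => hXsum t k k') hexit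
    have h := hincr j (by omega) hjn (by omega) Qm k hk k' hk'
    simp only [klTorusNorm] at h
    simp only [hX]
    linarith
  by_cases hQ0 : IsPairClassAt L Qm 0
  · -- the last pair-class scale `t`
    set t : ℕ := Nat.findGreatest (fun s => IsPairClassAt L Qm s) n with ht_def
    have htn : t ≤ n := Nat.findGreatest_le n
    have hQt : IsPairClassAt L Qm t := Nat.findGreatest_spec (P := fun s => IsPairClassAt L Qm s) (Nat.zero_le n) hQ0
    have hSt : ∑ j ∈ range t, τ j ≤ ∑ j ∈ range n, τ j :=
      sum_le_sum_of_subset_of_nonneg (range_mono htn) fun j _ _ => hτ0 j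
    have hSt0 : 0 ≤ ∑ j ∈ range t, τ j := sum_nonneg fun j _ => hτ0 j
    -- the ladder data up to `t`
    have hsteps' : ∀ i < t, ∃ w : TorusSite 2 L → ℝ, (∀ p, 0 ≤ w p) ∧ (∑ p, w p ≤ G.bhi) ∧
        ∃ N : Matrix (TorusSite 2 L) (TorusSite 2 L) ℂ,
          (1 + Matrix.diagonal (fun p => (w p : ℂ)) * klPairArray L M β U μ K i Qm) * N = 1 ∧
          ∀ k ∈ klBall L μ K, ∀ k' ∈ klBall L μ K,
            ‖klPairAmplitude L M β U μ K (i + 1) Qm k k' - (klPairArray L M β U μ K i Qm * N) k k'‖ ≤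
              (drivePBar G P U i + eremBar G P Qc U β L i) + X (i + 1) k k' := by
      intro i hi
      have h := (hsteps (i + 1) ((Nat.succ_le_of_lt hi).trans htn)).2 (Nat.le_add_left 1 i) Qm
        (isPairClassAt_mono L hQt (Nat.succ_le_of_lt hi))
      simp only [Nat.add_sub_cancel] at h
      obtain ⟨w, hw0, hwsum, N, hN, hb⟩ := h
      exact ⟨w, hw0, hwsum, N, hN, fun k hk k' hk' => by have := hb k hk k' hk'; simp only [hX]; linarith⟩
    have hXtot' : ∀ k k' : TorusSite 2 L, ∑ i ∈ range t, X (i + 1) k k' ≤ 4 / 3 * g2 + 40 * q3 := fun k k' =>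
      (sum_le_sum_of_subset_of_nonneg (range_mono htn) fun i _ _ => hX0 _ _ _).trans (hXtot k k')
    have hsmall' : 8 * 20 * ((initDevBar G U + ∑ j ∈ range t, τ j + (4 / 3 * g2 + 40 * q3)) +
        (∑ j ∈ range t, τ j + (g2 + 8 * q3))) * (G.bhi * t) ≤ 1 := by
      refine le_trans ?_ hsmall
      have ht' : (t : ℝ) ≤ n := by exact_mod_cast htn
      have h1 : (initDevBar G U + ∑ j ∈ range t, τ j + (4 / 3 * g2 + 40 * q3)) + (∑ j ∈ range t, τ j + (g2 + 8 * q3)) ≤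
          (initDevBar G U + ∑ j ∈ range n, τ j + (4 / 3 * g2 + 40 * q3)) + (∑ j ∈ range n, τ j + (g2 + 8 * q3)) := by
        linarith
      have hSn0 : 0 ≤ ∑ j ∈ range n, τ j := sum_nonneg fun j _ => hτ0 j
      have hX0' : 0 ≤ (initDevBar G U + ∑ j ∈ range n, τ j + (4 / 3 * g2 + 40 * q3)) +
          (∑ j ∈ range n, τ j + (g2 + 8 * q3)) := by nlinarith [hinit0, hg20, hSn0, hq30]
      exact mul_le_mul (mul_le_mul_of_nonneg_left h1 (by norm_num)) (mul_le_mul_of_nonneg_left ht' hbhi)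
        (mul_nonneg hbhi (Nat.cast_nonneg t)) (mul_nonneg (by norm_num) hX0')
    obtain ⟨u, hu0, huU, hu⟩ := pairLadder_envelope_extra L M hG hP hQc hU (n := t) (Qm := Qm) X hX0
      (fun i _ k k' => hXsup i k k') hXtot' (by positivity) (by positivity)
      (fun k hk k' hk' => (hsteps 0 (Nat.zero_le n)).1 rfl Qm k hk k' hk') hsteps' hsmall'
    refine ⟨u, hu0, huU, fun k hk k' hk' => ?_⟩
    have hfro : ‖klPairAmplitude L M β U μ K n Qm k k' - klPairAmplitude L M β U μ K t Qm k k'‖ ≤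
        (P.Klam * U) ^ 2 * (3 * G.CF) + (4 / 3 * g2 + 40 * q3) + ∑ i ∈ range n, eremBar G P Qc U β L i := by
      rcases htn.eq_or_lt with h | h
      · rw [h, sub_self, norm_zero]
        have : 0 ≤ (P.Klam * U) ^ 2 * (3 * G.CF) := by positivity
        linarith [hSe0, hg20, hq30]
      · have hnot : ¬ IsPairClassAt L Qm (t + 1) :=
          Nat.findGreatest_is_greatest (P := fun s => IsPairClassAt L Qm s) (Nat.lt_succ_self t) (Nat.succ_le_of_lt h)
        exact hfrozen t htn (lt_of_not_ge hnot) k hk k' hk'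
    have hlad := hu k hk k' hk'
    calc ‖klPairAmplitude L M β U μ K n Qm k k' - (u : ℂ)‖
        ≤ ‖klPairAmplitude L M β U μ K t Qm k k' - (u : ℂ)‖ +
            ‖klPairAmplitude L M β U μ K n Qm k k' - klPairAmplitude L M β U μ K t Qm k k'‖ := by
          rw [show klPairAmplitude L M β U μ K n Qm k k' - (u : ℂ) =
            (klPairAmplitude L M β U μ K t Qm k k' - (u : ℂ)) +
              (klPairAmplitude L M β U μ K n Qm k k' - klPairAmplitude L M β U μ K t Qm k k') by ring]
          exact norm_add_le _ _
      _ ≤ _ := by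
          refine (add_le_add hlad hfro).trans ?_
          simp only [hτ] at hSt ⊢
          nlinarith [hSt, hg20, hinit0, hSt0, hq30]
  · -- never in the pair class: frozen from scale 0 around the bare value `U`
    have hexit : ((4 : ℝ) ^ (0 + 1))⁻¹ < torusSupNorm (latticeMomentum L Qm 0, latticeMomentum L Qm 1) := by
      have h1 : ¬ torusSupNorm (latticeMomentum L Qm 0, latticeMomentum L Qm 1) ≤ ((4 : ℝ) ^ 0)⁻¹ := hQ0
      push Not at h1
      exact lt_trans (by norm_num) h1
    refine ⟨U, hU, le_rfl, fun k hk k' hk' => ?_⟩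
    have hfro := hfrozen 0 (Nat.zero_le n) hexit k hk k' hk'
    have h0 := (hsteps 0 (Nat.zero_le n)).1 rfl Qm k hk k' hk'
    have hS0 : 0 ≤ ∑ j ∈ range n, τ j := sum_nonneg fun j _ => hτ0 j
    calc ‖klPairAmplitude L M β U μ K n Qm k k' - (U : ℂ)‖
        ≤ ‖klPairAmplitude L M β U μ K n Qm k k' - klPairAmplitude L M β U μ K 0 Qm k k'‖ +
            ‖klPairAmplitude L M β U μ K 0 Qm k k' - (U : ℂ)‖ := by
          rw [show klPairAmplitude L M β U μ K n Qm k k' - (U : ℂ) =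
            (klPairAmplitude L M β U μ K n Qm k k' - klPairAmplitude L M β U μ K 0 Qm k k') +
              (klPairAmplitude L M β U μ K 0 Qm k k' - (U : ℂ)) by ring]
          exact norm_add_le _ _
      _ ≤ _ := by
          refine (add_le_add hfro h0).trans ?_
          simp only [hτ] at hS0
          nlinarith [hS0, hg20, hinit0, hq30]

/-- **Supplier-map row 0′ on the V7 slots, literally**: `EngineBoundsAtV5S` at every `j ≤ n` (it carries `PairLadderStepAtV5 j` and
`PairValueIncrementAtV5 j`) gives the `Q`-aware (B1-v2′) `PairArrayAtV2` at `n` once the smallness and the constant line are supplied. -/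
theorem pairArrayAtV2_of_engineBoundsV5S (hG : G.WF) (hP : P.WF) (hQc : Qc.WF) {β U μ : ℝ} {K : TrigPolyC4v} (hU : 0 ≤ U)
    (hU1 : |U| ≤ 1) {n : ℕ} (hn : n ≤ nScales β) (hE : ∀ j ≤ n, EngineBoundsAtV5S L M G P Qc β U μ K j)
    (hsmall : 8 * 20 * ((initDevBar G U + ∑ j ∈ range n, (drivePBar G P U j + eremBar G P Qc U β L j) +
        (4 / 3 * (G.CF * (P.Klam * U) ^ 2) + 40 * (Qc.CR * P.Klam ^ 3 * U ^ 2))) +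
        (∑ j ∈ range n, (drivePBar G P U j + eremBar G P Qc U β L j) +
          (G.CF * (P.Klam * U) ^ 2 + 8 * (Qc.CR * P.Klam ^ 3 * U ^ 2)))) * (G.bhi * n) ≤ 1)
    (hCW : 8 * ((initDevBar G U + ∑ j ∈ range n, (drivePBar G P U j + eremBar G P Qc U β L j) +
            (4 / 3 * (G.CF * (P.Klam * U) ^ 2) + 40 * (Qc.CR * P.Klam ^ 3 * U ^ 2))) +
          (∑ j ∈ range n, (drivePBar G P U j + eremBar G P Qc U β L j) +
            (G.CF * (P.Klam * U) ^ 2 + 8 * (Qc.CR * P.Klam ^ 3 * U ^ 2)))) +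
        ((P.Klam * U) ^ 2 * (3 * G.CF) + (4 / 3 * (G.CF * (P.Klam * U) ^ 2) + 40 * (Qc.CR * P.Klam ^ 3 * U ^ 2)) +
          ∑ i ∈ range n, eremBar G P Qc U β L i) ≤ (P.C_W + klLegKappa * Qc.CR * P.Klam ^ 3) * U ^ 2) :
    PairArrayAtV2 L M P Qc β U μ K n := by
  intro Qm
  obtain ⟨u, hu0, huU, hu⟩ := pairArray_envelope_v5 L M hG hP hQc hU hU1 hn (fun j hj => (hE j hj).2.2.1)
    (fun j _ hj => (hE j hj).2.2.2.1) Qm hsmall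
  exact ⟨u, hu0, huU.trans (by rw [abs_of_nonneg hU]; linarith), fun k hk k' hk' => (hu k hk k' hk').trans hCW⟩

set_option maxHeartbeats 400000 in
/-- **Row 0′ on the V7 slots with the constants chosen.**  With `C := 8(Σ_χ(abot+atop)+1) + 17(aplus Klam² Z + cloc Klam²(1−4^{-θ})⁻¹ + 1) + 1
+ 23·CF·Klam² ≤ P.C_W` (the `Q.CR·Klam³` part, `≤ 424`, is below `klLegKappa = 4000`), `2·CR·Klam³·|U| ≤ 1`, `|U| ≤ 1`, the volume line
`17·Σ_{j<n} CL β j/L ≤ U²` and the NO-ONSET line `160·((Σ_χ(abot+atop)+1) + 2(aplus Klam² Z + cloc Klam²(1−4^{-θ})⁻¹ + 1) + 1 + 3·CF·Klam² +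
48·CR·Klam³)·U²·(bhi·n) ≤ 1`, the engine bounds at the scales `≤ n ≤ n_β` give `PairArrayAtV2 L M P Q β U μ K n`. -/
theorem pairArrayAtV2_of_engineBoundsV5S_explicit (hG : G.WF) (hP : P.WF) (hQc : Qc.WF) {β U μ : ℝ} {K : TrigPolyC4v}
    (hU : 0 ≤ U) (hU1 : |U| ≤ 1) {n : ℕ} (hn : n ≤ nScales β) (hE : ∀ j ≤ n, EngineBoundsAtV5S L M G P Qc β U μ K j)
    (hUCR : 2 * Qc.CR * P.Klam ^ 3 * |U| ≤ 1) (hL : 17 * ∑ j ∈ range n, Qc.CL β j / L ≤ U ^ 2)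
    (hsmall : 8 * 20 * (((∑ χ : D4Irrep, (G.abot χ + G.atop χ) + 1) +
        2 * (G.aplus * P.Klam ^ 2 * G.Z + G.cloc * P.Klam ^ 2 * (1 - (4 : ℝ) ^ (-G.θ))⁻¹ + 1) + 1 +
          3 * (G.CF * P.Klam ^ 2) + 48 * (Qc.CR * P.Klam ^ 3)) * U ^ 2) * (G.bhi * n) ≤ 1)
    (hCW : 8 * (∑ χ : D4Irrep, (G.abot χ + G.atop χ) + 1) +
        17 * (G.aplus * P.Klam ^ 2 * G.Z + G.cloc * P.Klam ^ 2 * (1 - (4 : ℝ) ^ (-G.θ))⁻¹ + 1) + 1 +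
          23 * (G.CF * P.Klam ^ 2) ≤ P.C_W) :
    PairArrayAtV2 L M P Qc β U μ K n := by
  have hdrive := drivePBar_sum_le (P := P) hG U n
  have herem := eremBar_sum_le hG hP hQc U β L n
  have hU2 : 0 ≤ U ^ 2 := sq_nonneg U
  have hCL0 : 0 ≤ ∑ j ∈ range n, Qc.CL β j / L := sum_nonneg fun j _ => div_nonneg (hQc.2.2.2.2.2.2.2 β j) (Nat.cast_nonneg L)
  have hθ : 0 < G.θ := hG.2.2.2.2.2.1
  have hg : 0 ≤ (1 - (4 : ℝ) ^ (-G.θ))⁻¹ :=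
    inv_nonneg.2 (by have := Real.rpow_lt_one_of_one_lt_of_neg (x := (4 : ℝ)) (by norm_num) (by linarith : -G.θ < 0); linarith)
  have hK0 : 0 ≤ P.Klam := zero_le_one.trans hP.1
  have hcloc : 0 ≤ G.cloc := hG.2.2.2.2.1
  have haplus : 0 ≤ G.aplus := hG.2.2.2.2.2.2.2.2.2.2.1
  have hCF : 0 ≤ G.CF := hG.2.2.2.2.2.2.2.2.2.2.2.2.2.1
  have hCR : 0 ≤ Qc.CR := hQc.2.1
  have hbhi : 0 ≤ G.bhi := hG.2.2.1.trans hG.2.2.2.1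
  have hab : 0 ≤ ∑ χ : D4Irrep, (G.abot χ + G.atop χ) := sum_nonneg fun χ _ => add_nonneg (hG.2.1 χ) (hG.1 χ)
  have hK2 : 0 ≤ P.Klam ^ 2 * U ^ 2 := by positivity
  have hK3 : 0 ≤ Qc.CR * P.Klam ^ 3 * U ^ 2 := by positivity
  have hZ : 0 ≤ G.Z := le_trans (sum_nonneg fun j _ => hG.2.2.2.2.2.2.2.2.1 j) (hG.2.2.2.2.2.2.2.2.2.1 0)
  have hCRU : 2 * Qc.CR * P.Klam ^ 3 * |U| * U ^ 2 ≤ U ^ 2 := by nlinarith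
  have hS : ∑ j ∈ range n, (drivePBar G P U j + eremBar G P Qc U β L j) ≤
      (G.aplus * P.Klam ^ 2 * G.Z + G.cloc * P.Klam ^ 2 * (1 - (4 : ℝ) ^ (-G.θ))⁻¹ + 2 * Qc.CR * P.Klam ^ 3 * |U|) * U ^ 2 +
        ∑ j ∈ range n, Qc.CL β j / L := by
    rw [sum_add_distrib]; nlinarith [hdrive, herem]
  have hS0 : 0 ≤ ∑ j ∈ range n, (drivePBar G P U j + eremBar G P Qc U β L j) :=
    sum_nonneg fun j _ => add_nonneg (drivePBar_nonneg' hG U j) (eremBar_nonneg' hG hP hQc U β L j)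
  have hinit : initDevBar G U = (∑ χ : D4Irrep, (G.abot χ + G.atop χ) + 1) * U ^ 2 := rfl
  have hn0 : (0 : ℝ) ≤ n := Nat.cast_nonneg n
  have hSe0 : 0 ≤ ∑ i ∈ range n, eremBar G P Qc U β L i := sum_nonneg fun i _ => eremBar_nonneg' hG hP hQc U β L i
  have hκ : klLegKappa = 4000 := rfl
  refine pairArrayAtV2_of_engineBoundsV5S L M hG hP hQc hU hU1 hn hE ?_ ?_
  · refine le_trans ?_ hsmall
    have hmain : (initDevBar G U + ∑ j ∈ range n, (drivePBar G P U j + eremBar G P Qc U β L j) +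
        (4 / 3 * (G.CF * (P.Klam * U) ^ 2) + 40 * (Qc.CR * P.Klam ^ 3 * U ^ 2))) +
        (∑ j ∈ range n, (drivePBar G P U j + eremBar G P Qc U β L j) +
          (G.CF * (P.Klam * U) ^ 2 + 8 * (Qc.CR * P.Klam ^ 3 * U ^ 2))) ≤
        ((∑ χ : D4Irrep, (G.abot χ + G.atop χ) + 1) +
          2 * (G.aplus * P.Klam ^ 2 * G.Z + G.cloc * P.Klam ^ 2 * (1 - (4 : ℝ) ^ (-G.θ))⁻¹ + 1) + 1 +
            3 * (G.CF * P.Klam ^ 2) + 48 * (Qc.CR * P.Klam ^ 3)) * U ^ 2 := by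
      rw [hinit]; nlinarith [hS, hCRU, hL, hCL0, mul_nonneg hCF hK2]
    have h0 : 0 ≤ (initDevBar G U + ∑ j ∈ range n, (drivePBar G P U j + eremBar G P Qc U β L j) +
        (4 / 3 * (G.CF * (P.Klam * U) ^ 2) + 40 * (Qc.CR * P.Klam ^ 3 * U ^ 2))) +
        (∑ j ∈ range n, (drivePBar G P U j + eremBar G P Qc U β L j) +
          (G.CF * (P.Klam * U) ^ 2 + 8 * (Qc.CR * P.Klam ^ 3 * U ^ 2))) := by
      rw [hinit]; positivity
    exact mul_le_mul_of_nonneg_right (mul_le_mul_of_nonneg_left hmain (by norm_num)) (mul_nonneg hbhi hn0)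
  · rw [hκ]
    have herem' : ∑ i ∈ range n, eremBar G P Qc U β L i ≤
        (G.cloc * P.Klam ^ 2 * (1 - (4 : ℝ) ^ (-G.θ))⁻¹ + 2 * Qc.CR * P.Klam ^ 3 * |U|) * U ^ 2 +
          ∑ j ∈ range n, Qc.CL β j / L := herem
    -- the `Σ(drivePBar + ē)`-type terms: `16·S + Σē ≤ (17(aKZ + cKg) + 18)·U²`
    have hT1 : 16 * ∑ j ∈ range n, (drivePBar G P U j + eremBar G P Qc U β L j) + ∑ i ∈ range n, eremBar G P Qc U β L i ≤
        (17 * (G.aplus * P.Klam ^ 2 * G.Z + G.cloc * P.Klam ^ 2 * (1 - (4 : ℝ) ^ (-G.θ))⁻¹) + 18) * U ^ 2 := by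
      nlinarith [hS, herem', hCRU, hL, hCL0, mul_nonneg haplus (mul_nonneg hK2 hZ)]
    have hg2 : (P.Klam * U) ^ 2 = P.Klam ^ 2 * U ^ 2 := by ring
    have hCWU := mul_le_mul_of_nonneg_right hCW hU2
    rw [hinit, hg2]
    linarith [hT1, hCWU, hK3]

end Model

end Summit.HubbardSuperconductivity.HubbardSuperconductivity.Theorems.KLRegimeSplit

end
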